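import Summits.ResolutionOfSingularities.ResolutionOfSingularities.Theses.HomologicalConductor
import Literature.AlgebraicGeometry.Resolution.TranscendenceDefect
import Literature.AlgebraicGeometry.Resolution.PrimeDivisors
import Literature.AlgebraicGeometry.Resolution.AbhyankarInvariants
import Literature.AlgebraicGeometry.Resolution.FieldsJ2

/-!
# Crux `NoZeno` (stmt-ResolutionOfSingularities-16483) — the two HABITATS of the surface kernel

Route `ResolutionOfSingularities/HomologicalConductor`, crux
`Summit.ResolutionOfSingularities.ResolutionOfSingularities.Theses.HomologicalConductor.NoZeno`,
line `birth`, open stub `stub_kernelRankOne` at transcendence degree `2` (K4.4's C2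
`SurfaceRankOneCore`). Negative lane (`--supports` the crux item): structure lemmas about the kernel,
no Theses decl is asserted; OURS (res-L0-w44-tri-1, BARRIER & DEFECT triage calibration).

After `surfaceKernel_exhausts` (same directory) the surface kernel is a NON-noetherian valuation ring
`O ∋ k`, `O ≠ K`, of a finitely generated `K/k` with `trdeg_k K = 2`, exhausted by its `ca`-tower.
`surfaceKernel_habitat`: such an `O` is ZERO-dimensional (`residueTrdeg = 0`, residue field algebraic
over `k` — a one-dimensional `O` would be a prime divisor, a DVR by Zariski–Samuel VI §14 Thm 31
(tree `isDiscreteValuationRing_of_residueTrdeg`), hence noetherian) and lies in exactly one of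
* the ABHYANKAR habitat H-irr: `ratRank O = 2`, transcendence defect `0`, value group a finitely
  generated group (Temkin 2013 Rem. 2.1.3, tree `valueGroup_fg_of_transcendenceDefect_eq_zero`) —
  in Lean: `HIrrDatum.hIrr_datum` (`wtRing k`, `Γ = ℤ + ℤ√2`);
* the DEFECT habitat H-def: `ratRank O = 1`, transcendence defect `1` (value group a non-discrete
  subgroup of `ℚ`, e.g. `ℤ[1/p]`; residue field algebraic, possibly infinite / inseparable over `k`).
`surfaceKernel_ratRank_one_of_not_fg`: a non-finitely-generated value group forces H-def.
`surfaceKernel_habitat_datum`: the same over the crux binders (`A.FG`, `IsFractionRing A K`).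
Every idea card for the surface kernel must cover BOTH habitats (kill test K4.4: irrational-slope
toric towers = H-irr; Artin–Schreier / unbounded-denominator towers = H-def).

Kernel-only (axioms `propext`, `Classical.choice`, `Quot.sound`); no `def`, no named fact.
-/

set_option linter.dupNamespace false

noncomputable section

namespace Summit.ResolutionOfSingularities.ResolutionOfSingularities.Theorems.NoZeno.Negative

open Literature.AlgebraicGeometry.Resolution

variable {k K : Type} [Field k] [Field K] [Algebra k K]

/-- **Surface kernel habitats.** A NON-noetherian valuation ring `O ∋ k`, `O ≠ K`, of a finitely
generated `K/k` of transcendence degree `2` is zero-dimensional (`residueTrdeg = 0`: residue field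
algebraic over `k`) and lies in exactly one of two habitats: ABHYANKAR (`ratRank = 2`, transcendence
defect `0`) or DEFECT (`ratRank = 1`, transcendence defect `1`). (A one-dimensional `O` would be a
prime divisor, hence a DVR by Zariski–Samuel VI §14 Thm 31, hence noetherian.) [folklore] -/
theorem surfaceKernel_habitat (O : ValuationSubring K) (hk : ∀ c : k, algebraMap k K c ∈ O)
    (hfg : (⊤ : IntermediateField k K).FG) (hO : O ≠ ⊤) (hN : ¬ IsNoetherianRing O)
    (htr : Algebra.trdeg k K = 2) :
    residueTrdeg k O hk = 0 ∧
      ((ratRank O = 2 ∧ transcendenceDefect k O hk = 0) ∨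
        (ratRank O = 1 ∧ transcendenceDefect k O hk = 1)) := by
  have hNat : Algebra.trdeg k K < Cardinal.aleph0 := trdeg_lt_aleph0_of_fg hfg
  obtain ⟨e, he⟩ := Cardinal.lt_aleph0.mp (ratRank_lt_aleph0 O hk hNat)
  obtain ⟨f, hf⟩ := Cardinal.lt_aleph0.mp (residueTrdeg_lt_aleph0 O hk hNat)
  have he1 : 1 ≤ e := by
    have h := one_le_ratRank_of_ne_top O hO
    rw [he] at h
    exact_mod_cast h
  have hsum : e + f ≤ 2 := by
    have h := ratRank_add_residueTrdeg_le_trdeg O hk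
    rw [he, hf, htr] at h
    exact_mod_cast h
  have hdef : transcendenceDefect k O hk + e + f = 2 := by
    have h := transcendenceDefect_add_toNat_eq O hk hNat
    rw [he, hf, htr] at h
    simpa using h
  -- `f = 1` is impossible: `O` would be a prime divisor, hence a DVR, hence noetherian
  have hf0 : f = 0 := by
    by_contra hf0
    have hf1 : f = 1 := by omega
    have hF : residueTrdeg k O hk + 1 = Algebra.trdeg k K := by
      rw [hf, htr, hf1]; norm_num
    haveI := isDiscreteValuationRing_of_residueTrdeg O hk hfg hO hF
    exact hN inferInstance
  subst hf0
  refine ⟨by rw [hf]; rfl, ?_⟩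
  rcases Nat.lt_or_ge e 2 with hlt | hge
  · have he' : e = 1 := by omega
    subst he'
    right
    exact ⟨by rw [he]; rfl, by omega⟩
  · have he' : e = 2 := by omega
    subst he'
    left
    exact ⟨by rw [he]; rfl, by omega⟩

/-- In the Abhyankar habitat the value group is a finitely generated group (Temkin 2013 Rem. 2.1.3,
tree `valueGroup_fg_of_transcendenceDefect_eq_zero`); so a surface-kernel `O` whose value group is
NOT finitely generated (e.g. `ℤ[1/p]`, unbounded denominators) is in the DEFECT habitat. [folklore] -/
theorem surfaceKernel_ratRank_one_of_not_fg (O : ValuationSubring K)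
    (hk : ∀ c : k, algebraMap k K c ∈ O) (hfg : (⊤ : IntermediateField k K).FG) (hO : O ≠ ⊤)
    (hN : ¬ IsNoetherianRing O) (htr : Algebra.trdeg k K = 2)
    (hnfg : ¬ Group.FG (ValuationSubring.ValueGroup O)ˣ) :
    ratRank O = 1 ∧ transcendenceDefect k O hk = 1 := by
  rcases (surfaceKernel_habitat O hk hfg hO hN htr).2 with ⟨_, hD⟩ | h
  · exact absurd (valueGroup_fg_of_transcendenceDefect_eq_zero O hfg hk hD) hnfg
  · exact h

/-- **Datum form** (binders of the crux): for a `NoZeno` datum `(O, A)` on a surface (`trdeg = 2`)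
with `O ≠ K` non-noetherian — the surface KERNEL after `surfaceKernel_exhausts` — the habitat
alternative holds. [folklore] -/
theorem surfaceKernel_habitat_datum (O : ValuationSubring K) (A : Subalgebra k K)
    (hk : ∀ c : k, algebraMap k K c ∈ O) (hA : A.FG) (hfr : IsFractionRing ↥A K)
    (hO : O ≠ ⊤) (hN : ¬ IsNoetherianRing O) (htr : Algebra.trdeg k K = 2) :
    residueTrdeg k O hk = 0 ∧
      ((ratRank O = 2 ∧ transcendenceDefect k O hk = 0 ∧
          Group.FG (ValuationSubring.ValueGroup O)ˣ) ∨
        (ratRank O = 1 ∧ transcendenceDefect k O hk = 1)) := by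
  haveI : Algebra.FiniteType k ↥A := A.fg_iff_finiteType.mp hA
  haveI := hfr
  have hfg : (⊤ : IntermediateField k K).FG :=
    IntermediateField.fg_top_of_isFractionRing_of_finiteType k ↥A K
  obtain ⟨h0, h⟩ := surfaceKernel_habitat O hk hfg hO hN htr
  refine ⟨h0, ?_⟩
  rcases h with ⟨h2, hD⟩ | h1
  · exact Or.inl ⟨h2, hD, valueGroup_fg_of_transcendenceDefect_eq_zero O hfg hk hD⟩
  · exact Or.inr h1

end Summit.ResolutionOfSingularities.ResolutionOfSingularities.Theorems.NoZeno.Negative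

end
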